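import Mathlib.Data.ZMod.Basic
import Mathlib.Algebra.Field.ZMod
import Mathlib.Data.ZMod.Units
import Mathlib.Data.Fintype.Card
import Mathlib.LinearAlgebra.Matrix.GeneralLinearGroup.Defs
import Mathlib.LinearAlgebra.Matrix.GeneralLinearGroup.Card
import Mathlib.LinearAlgebra.Matrix.Notation
import Mathlib.GroupTheory.Abelianization.Defs
import Mathlib.GroupTheory.Commutator.Basic
import Mathlib.GroupTheory.Index
import Mathlib.Tactic.DeriveFintype
import HarnessLib

/-!
# X11b at `p = 3` (team N8/O2), sub-target S6 · IMG3a, part (a): the group theory of `GL₂(𝔽₃)`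
# that replaces "`p ≥ 5`" image arguments — `SL₂(𝔽₃)` is the UNIQUE subgroup of index `2`, it is
# the commutator subgroup, and a surjection onto `GL₂(𝔽₃)` stays surjective on every index-`2`
# subgroup other than the determinant kernel

HONEST FRAMING (cell `b2b-bsdres`, run/shared/lean/b2b/bsd-rank1-residual/, verbatim in every
file): the goal of the cell is to DELETE the COMBINATION-SHAPED residual classes of the
Birch–Swinnerton-Dyer formula for ALL analytic-rank `≤ 1` elliptic curves over `ℚ` — "full BSD
formula for every rank `≤ 1` curve in class `C`" assembled STRICTLY from published theorems — so
that the rank-`≤ 1` remainder becomes exactly the CONSTRUCTION-SHAPED classes, which are TYPED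
(missing-input `Prop`s), NOT attempted. This is not "finishing BSD". Team N8/O2 = `x11b3` (X11b at
`p = 3`), seat `b2b-bsdres-x11b3-p1`, sub-target S6 of `cells/x11b3/PLAN.md` (part (a), "group
part first"); nothing here is specific to elliptic curves, nothing is booked, no label changes.
One computational MODEL (a record of four entries of `𝔽₃`, as in the tree's
`GaloisRepresentations/GL2F5OrderThree.lean` and `GL2F3Lift.lean`) and THEOREMS; no named fact; no
`sorry`; certificates by plain `decide` (kernel reduction, no `native_decide`).

## Why the team needs this (PLAN §1 "p = 3-ONLY phenomena", §2 S6/K4)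

At `p ≥ 5` the architectures reaching `p ∥ N` use "`PSL₂(𝔽_p)` simple / `p ∤ #GL₂(𝔽_p)`-type"
shortcuts for: (β) "`ρ̄|_{G_K}` is still surjective / absolutely irreducible for the Heegner field
`K`" (Skinner–Zhang 2014, Howard 2004 "`Gal(K̄/K) → Aut(T)` surjective", BCK 2021), and (γ) the
quadratic subfields of `ℚ(E[p])`. At `p = 3`, `#GL₂(𝔽₃) = 48` is divisible by `3` and `GL₂(𝔽₃)`
is solvable (tree: `GL2F3Lift.isSolvable_GL_fin_two_zmod_three`), so those shortcuts die; what
survives is the elementary structure proved here: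

* `GL2F3.eq_ker_det_of_index_two` — **every subgroup of index `2` of `GL₂(𝔽₃)` is `SL₂(𝔽₃)`**
  (`= ker det`): an index-`2` subgroup contains all squares, and every element of determinant `1`
  is a product of two squares (certificate `M2.sq_certificate`, 24 identities);
* `GL2F3.commutator_eq_ker_det` — **`[GL₂(𝔽₃), GL₂(𝔽₃)] = SL₂(𝔽₃)`**, so `GL₂(𝔽₃)^{ab} ≅ 𝔽₃^× ≅
  ℤ/2` via `det` and `−1 ∈ [G,G]` (`neg_one_mem_commutator`): every element of determinant `1` is a
  SINGLE commutator (certificate `M2.comm_certificate`);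
* `GL2F3.index_ker_det` — `[GL₂(𝔽₃) : SL₂(𝔽₃)] = 2`;
* transport to any group `A ≃* GL₂(𝔽₃)` (`eq_ker_of_index_two_of_mulEquiv`,
  `index_two_unique_of_mulEquiv`) and the form used downstream:
  **`map_eq_top_or_eq_ker_of_index_two`** — for a SURJECTIVE `ρ : Γ →* A` and `Γ' ≤ Γ` of index
  `2`, either `ρ(Γ') = A` (still surjective) or `Γ' = ker(det ∘ ρ)`.

Dictionary for part (b) (the field corollary, to be filed on the tree's division-field vocabulary
once the Weil-pairing identification `det ∘ ρ̄_{E,3} = χ₃` and the index-`2` subgroup `G_K ≤ G_ℚ`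
are located): `Γ = G_ℚ`, `Γ' = G_K` for a quadratic `K`, `ρ = ρ̄_{E,3}` with `Surj W 3`,
`ker(det ∘ ρ) = ker χ₃ = G_{ℚ(√−3)}`; so `K ≠ ℚ(√−3)` (automatic for a Heegner field at `3 ∣ N_E`,
`StepLAtThree.lean` §1) gives `ρ̄_{E,3}(G_K) = Aut(E[3])`, and the unique quadratic subfield of
`ℚ(E[3])` is `ℚ(√−3)`.

References: J.-P. Serre, *Propriétés galoisiennes des points d'ordre fini des courbes
elliptiques*, Invent. Math. 15 (1972) §2 (subgroups of `GL₂(𝔽_p)`); C.-H. Sah / standard group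
theory for `GL₂(𝔽₃) ≅ 2.S₄`-type facts; team file `cells/x11b3/PLAN.md` §1–§2 (S6, K4).
-/

namespace Summit.BirchSwinnertonDyer.Rank1Residual.X11b.Three

namespace GL2F3

open Matrix
open scoped commutatorElement

/-! ### The computational model: `2 × 2` arrays over `𝔽₃` -/

/-- A `2 × 2` array `(a b; c d)` over `𝔽₃` with decidable equality and a `Fintype` instance, on
which the certificates are checked by `decide`; `M2.toMat` turns it into a
`Matrix (Fin 2) (Fin 2) (ZMod 3)`. [folklore] -/
structure M2 where
  /-- entry `(0,0)` -/
  a : ZMod 3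
  /-- entry `(0,1)` -/
  b : ZMod 3
  /-- entry `(1,0)` -/
  c : ZMod 3
  /-- entry `(1,1)` -/
  d : ZMod 3
deriving DecidableEq, Fintype

namespace M2

/-- Matrix product on the encoding. [folklore] -/
def mul (x y : M2) : M2 :=
  ⟨x.a * y.a + x.b * y.c, x.a * y.b + x.b * y.d, x.c * y.a + x.d * y.c, x.c * y.b + x.d * y.d⟩

/-- Determinant `a d − b c`. [folklore] -/
def det (x : M2) : ZMod 3 := x.a * x.d - x.b * x.c

/-- The matrix encoded by `x`. [folklore] -/
def toMat (x : M2) : Matrix (Fin 2) (Fin 2) (ZMod 3) := !![x.a, x.b; x.c, x.d]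

/-- The encoding of a matrix. [folklore] -/
def ofMat (g : Matrix (Fin 2) (Fin 2) (ZMod 3)) : M2 := ⟨g 0 0, g 0 1, g 1 0, g 1 1⟩

/-- `toMat ∘ ofMat = id`. [folklore] -/
theorem toMat_ofMat (g : Matrix (Fin 2) (Fin 2) (ZMod 3)) : toMat (ofMat g) = g :=
  (Matrix.eta_fin_two g).symm

/-- `toMat` is multiplicative. [folklore] -/
theorem toMat_mul (x y : M2) : toMat (mul x y) = toMat x * toMat y := by
  simp only [toMat, mul, Matrix.mul_fin_two]

/-- `toMat` carries `det` to `Matrix.det`. [folklore] -/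
theorem det_toMat (x : M2) : (toMat x).det = det x := by
  simp only [toMat, det, Matrix.det_fin_two_of]

/-- **Square-root table**: for each of the `24` elements `x` of determinant `1`, a pair `(y, z)` of
invertible arrays with `x = y² z²` (found by exhaustive search; `z = 1` whenever `x` is itself a
square). Off `SL₂(𝔽₃)` the value is junk `(1, 1)`. [folklore] -/
def sqTable (x : M2) : M2 × M2 :=
  if x = ⟨0, 1, 2, 0⟩ then (⟨1, 2, 1, 1⟩, ⟨1, 0, 0, 1⟩) else
  if x = ⟨0, 1, 2, 1⟩ then (⟨0, 1, 2, 0⟩, ⟨1, 2, 1, 0⟩) else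
  if x = ⟨0, 1, 2, 2⟩ then (⟨1, 1, 2, 0⟩, ⟨1, 0, 0, 1⟩) else
  if x = ⟨0, 2, 1, 0⟩ then (⟨1, 1, 2, 1⟩, ⟨1, 0, 0, 1⟩) else
  if x = ⟨0, 2, 1, 1⟩ then (⟨0, 1, 2, 0⟩, ⟨1, 1, 2, 0⟩) else
  if x = ⟨0, 2, 1, 2⟩ then (⟨1, 2, 1, 0⟩, ⟨1, 0, 0, 1⟩) else
  if x = ⟨1, 0, 0, 1⟩ then (⟨0, 1, 1, 0⟩, ⟨1, 0, 0, 1⟩) else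
  if x = ⟨1, 0, 1, 1⟩ then (⟨1, 0, 2, 1⟩, ⟨1, 0, 0, 1⟩) else
  if x = ⟨1, 0, 2, 1⟩ then (⟨1, 0, 1, 1⟩, ⟨1, 0, 0, 1⟩) else
  if x = ⟨1, 1, 0, 1⟩ then (⟨1, 2, 0, 1⟩, ⟨1, 0, 0, 1⟩) else
  if x = ⟨1, 1, 1, 2⟩ then (⟨0, 1, 1, 1⟩, ⟨1, 0, 0, 1⟩) else
  if x = ⟨1, 1, 2, 0⟩ then (⟨0, 1, 1, 1⟩, ⟨1, 2, 1, 0⟩) else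
  if x = ⟨1, 2, 0, 1⟩ then (⟨1, 1, 0, 1⟩, ⟨1, 0, 0, 1⟩) else
  if x = ⟨1, 2, 1, 0⟩ then (⟨0, 1, 1, 1⟩, ⟨1, 2, 0, 1⟩) else
  if x = ⟨1, 2, 2, 2⟩ then (⟨0, 1, 1, 2⟩, ⟨1, 0, 0, 1⟩) else
  if x = ⟨2, 0, 0, 2⟩ then (⟨0, 1, 2, 0⟩, ⟨1, 0, 0, 1⟩) else
  if x = ⟨2, 0, 1, 2⟩ then (⟨0, 1, 1, 1⟩, ⟨1, 1, 2, 0⟩) else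
  if x = ⟨2, 0, 2, 2⟩ then (⟨0, 1, 1, 2⟩, ⟨1, 2, 1, 0⟩) else
  if x = ⟨2, 1, 0, 2⟩ then (⟨0, 1, 1, 1⟩, ⟨1, 0, 2, 1⟩) else
  if x = ⟨2, 1, 1, 1⟩ then (⟨1, 1, 1, 0⟩, ⟨1, 0, 0, 1⟩) else
  if x = ⟨2, 1, 2, 0⟩ then (⟨0, 1, 2, 1⟩, ⟨1, 0, 0, 1⟩) else
  if x = ⟨2, 2, 0, 2⟩ then (⟨0, 1, 1, 2⟩, ⟨1, 0, 1, 1⟩) else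
  if x = ⟨2, 2, 1, 0⟩ then (⟨0, 1, 2, 2⟩, ⟨1, 0, 0, 1⟩) else
  if x = ⟨2, 2, 2, 1⟩ then (⟨1, 2, 2, 0⟩, ⟨1, 0, 0, 1⟩) else
  (⟨1, 0, 0, 1⟩, ⟨1, 0, 0, 1⟩)

/-- **Commutator table**: for each `x` of determinant `1`, a pair `(y, z)` of invertible arrays
with `x = y z y⁻¹ z⁻¹`, recorded inverse-free as `y z = x z y` (exhaustive search: every element of
`SL₂(𝔽₃)` is a single commutator in `GL₂(𝔽₃)`). Junk `(1, 1)` off `SL₂(𝔽₃)`. [folklore] -/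
def commTable (x : M2) : M2 × M2 :=
  if x = ⟨0, 1, 2, 0⟩ then (⟨0, 1, 1, 0⟩, ⟨1, 2, 1, 1⟩) else
  if x = ⟨0, 1, 2, 1⟩ then (⟨0, 1, 1, 0⟩, ⟨0, 1, 1, 1⟩) else
  if x = ⟨0, 1, 2, 2⟩ then (⟨0, 1, 1, 0⟩, ⟨0, 1, 2, 2⟩) else
  if x = ⟨0, 2, 1, 0⟩ then (⟨0, 1, 1, 0⟩, ⟨1, 1, 1, 2⟩) else
  if x = ⟨0, 2, 1, 1⟩ then (⟨0, 1, 1, 0⟩, ⟨0, 1, 1, 2⟩) else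
  if x = ⟨0, 2, 1, 2⟩ then (⟨0, 1, 1, 0⟩, ⟨0, 1, 2, 1⟩) else
  if x = ⟨1, 0, 0, 1⟩ then (⟨0, 1, 1, 0⟩, ⟨0, 1, 1, 0⟩) else
  if x = ⟨1, 0, 1, 1⟩ then (⟨1, 0, 0, 2⟩, ⟨1, 0, 1, 1⟩) else
  if x = ⟨1, 0, 2, 1⟩ then (⟨1, 0, 0, 2⟩, ⟨1, 0, 2, 1⟩) else
  if x = ⟨1, 1, 0, 1⟩ then (⟨1, 0, 0, 2⟩, ⟨1, 1, 0, 1⟩) else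
  if x = ⟨1, 1, 1, 2⟩ then (⟨0, 1, 2, 0⟩, ⟨0, 1, 1, 1⟩) else
  if x = ⟨1, 1, 2, 0⟩ then (⟨0, 1, 1, 0⟩, ⟨1, 2, 0, 1⟩) else
  if x = ⟨1, 2, 0, 1⟩ then (⟨1, 0, 0, 2⟩, ⟨1, 1, 0, 2⟩) else
  if x = ⟨1, 2, 1, 0⟩ then (⟨0, 1, 1, 0⟩, ⟨1, 1, 0, 1⟩) else
  if x = ⟨1, 2, 2, 2⟩ then (⟨0, 1, 2, 0⟩, ⟨0, 1, 1, 2⟩) else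
  if x = ⟨2, 0, 0, 2⟩ then (⟨0, 1, 1, 0⟩, ⟨0, 1, 2, 0⟩) else
  if x = ⟨2, 0, 1, 2⟩ then (⟨0, 1, 1, 1⟩, ⟨0, 1, 2, 2⟩) else
  if x = ⟨2, 0, 2, 2⟩ then (⟨0, 1, 1, 2⟩, ⟨0, 1, 2, 1⟩) else
  if x = ⟨2, 1, 0, 2⟩ then (⟨0, 1, 1, 1⟩, ⟨0, 1, 1, 2⟩) else
  if x = ⟨2, 1, 1, 1⟩ then (⟨0, 1, 1, 2⟩, ⟨0, 1, 2, 0⟩) else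
  if x = ⟨2, 1, 2, 0⟩ then (⟨0, 1, 1, 0⟩, ⟨1, 2, 0, 2⟩) else
  if x = ⟨2, 2, 0, 2⟩ then (⟨0, 1, 1, 2⟩, ⟨0, 1, 1, 1⟩) else
  if x = ⟨2, 2, 1, 0⟩ then (⟨0, 1, 1, 0⟩, ⟨1, 1, 0, 2⟩) else
  if x = ⟨2, 2, 2, 1⟩ then (⟨0, 1, 1, 1⟩, ⟨0, 1, 2, 0⟩) else
  (⟨1, 0, 0, 1⟩, ⟨1, 0, 0, 1⟩)

/-- **Certificate 1 (squares):** every array of determinant `1` is `y² z²` with `y, z` invertible,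
as read off `sqTable`. Checked by `decide` over the `81` arrays. [folklore] -/
theorem sq_certificate : ∀ x : M2, det x = 1 →
    det (sqTable x).1 ≠ 0 ∧ det (sqTable x).2 ≠ 0 ∧
      x = mul (mul (sqTable x).1 (sqTable x).1) (mul (sqTable x).2 (sqTable x).2) := by
  decide

/-- **Certificate 2 (commutators):** every array `x` of determinant `1` satisfies `y z = x z y`
for the invertible pair `(y, z) = commTable x`, i.e. `x = y z y⁻¹ z⁻¹`. Checked by `decide`.
[folklore] -/
theorem comm_certificate : ∀ x : M2, det x = 1 →
    det (commTable x).1 ≠ 0 ∧ det (commTable x).2 ≠ 0 ∧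
      mul (commTable x).1 (commTable x).2 = mul (mul x (commTable x).2) (commTable x).1 := by
  decide

end M2

/-! ### Transport to `GL (Fin 2) (ZMod 3)` -/

/-- The invertible matrix attached to an array of non-zero determinant. [folklore] -/
noncomputable def toGL (x : M2) (hx : M2.det x ≠ 0) : GL (Fin 2) (ZMod 3) :=
  Matrix.GeneralLinearGroup.mkOfDetNeZero (M2.toMat x) (by rwa [M2.det_toMat])

/-- The underlying matrix of `toGL x`. [folklore] -/
@[simp] theorem val_toGL (x : M2) (hx : M2.det x ≠ 0) :
    ((toGL x hx : GL (Fin 2) (ZMod 3)) : Matrix (Fin 2) (Fin 2) (ZMod 3)) = M2.toMat x := rfl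

/-- `g ∈ ker det ↔ det (g : Matrix) = 1`. [folklore] -/
theorem mem_ker_det_iff (g : GL (Fin 2) (ZMod 3)) :
    g ∈ (Matrix.GeneralLinearGroup.det : GL (Fin 2) (ZMod 3) →* (ZMod 3)ˣ).ker ↔
      (g : Matrix (Fin 2) (Fin 2) (ZMod 3)).det = 1 := by
  rw [MonoidHom.mem_ker, ← Units.val_eq_one, Matrix.GeneralLinearGroup.val_det_apply]

/-- **Every element of `SL₂(𝔽₃)` is a product of two squares in `GL₂(𝔽₃)`.** [folklore] -/
theorem exists_eq_sq_mul_sq (g : GL (Fin 2) (ZMod 3))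
    (hg : (g : Matrix (Fin 2) (Fin 2) (ZMod 3)).det = 1) :
    ∃ a b : GL (Fin 2) (ZMod 3), g = a * a * (b * b) := by
  set x : M2 := M2.ofMat (g : Matrix (Fin 2) (Fin 2) (ZMod 3)) with hxdef
  have hxg : M2.toMat x = (g : Matrix (Fin 2) (Fin 2) (ZMod 3)) := M2.toMat_ofMat _
  have hx : M2.det x = 1 := by rw [← M2.det_toMat, hxg, hg]
  obtain ⟨hy, hz, heq⟩ := M2.sq_certificate x hx
  refine ⟨toGL _ hy, toGL _ hz, ?_⟩
  apply Matrix.GeneralLinearGroup.ext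
  intro i j
  have hmat : (g : Matrix (Fin 2) (Fin 2) (ZMod 3)) =
      M2.toMat (M2.sqTable x).1 * M2.toMat (M2.sqTable x).1 *
        (M2.toMat (M2.sqTable x).2 * M2.toMat (M2.sqTable x).2) := by
    rw [← hxg, ← M2.toMat_mul, ← M2.toMat_mul, ← M2.toMat_mul, ← heq]
  rw [Units.val_mul, Units.val_mul, Units.val_mul, val_toGL, val_toGL, hmat]

/-- **Every element of `SL₂(𝔽₃)` is a commutator in `GL₂(𝔽₃)`.** [folklore] -/
theorem exists_eq_commutatorElement (g : GL (Fin 2) (ZMod 3))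
    (hg : (g : Matrix (Fin 2) (Fin 2) (ZMod 3)).det = 1) :
    ∃ a b : GL (Fin 2) (ZMod 3), g = ⁅a, b⁆ := by
  set x : M2 := M2.ofMat (g : Matrix (Fin 2) (Fin 2) (ZMod 3)) with hxdef
  have hxg : M2.toMat x = (g : Matrix (Fin 2) (Fin 2) (ZMod 3)) := M2.toMat_ofMat _
  have hx : M2.det x = 1 := by rw [← M2.det_toMat, hxg, hg]
  obtain ⟨hy, hz, heq⟩ := M2.comm_certificate x hx
  refine ⟨toGL _ hy, toGL _ hz, ?_⟩
  -- `a b = g b a` in `GL₂(𝔽₃)`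
  have hab : toGL _ hy * toGL _ hz = g * toGL _ hz * toGL _ hy := by
    apply Matrix.GeneralLinearGroup.ext
    intro i j
    rw [Units.val_mul, Units.val_mul, Units.val_mul, val_toGL, val_toGL, ← hxg, ← M2.toMat_mul,
      ← M2.toMat_mul, ← M2.toMat_mul, heq]
  rw [commutatorElement_def, hab]
  group

/-- **`ker det ≤ H` for every subgroup `H` of index `2`**: `H` contains all squares
(`Subgroup.mul_self_mem_of_index_two`), hence every product of two squares. [folklore] -/
theorem ker_det_le_of_index_two (H : Subgroup (GL (Fin 2) (ZMod 3))) (hH : H.index = 2) :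
    (Matrix.GeneralLinearGroup.det : GL (Fin 2) (ZMod 3) →* (ZMod 3)ˣ).ker ≤ H := by
  intro g hg
  obtain ⟨a, b, rfl⟩ := exists_eq_sq_mul_sq g ((mem_ker_det_iff g).mp hg)
  exact H.mul_mem (Subgroup.mul_self_mem_of_index_two hH a)
    (Subgroup.mul_self_mem_of_index_two hH b)

/-- `det : GL₂(𝔽₃) → 𝔽₃^×` is onto (`diag(u, 1) ↦ u`). [folklore] -/
theorem det_surjective :
    Function.Surjective (Matrix.GeneralLinearGroup.det : GL (Fin 2) (ZMod 3) →* (ZMod 3)ˣ) := by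
  intro u
  refine ⟨Matrix.GeneralLinearGroup.mkOfDetNeZero !![(u : ZMod 3), 0; 0, 1] ?_, ?_⟩
  · rw [Matrix.det_fin_two_of]; simp
  · ext
    rw [Matrix.GeneralLinearGroup.val_det_apply]
    simp [Matrix.det_fin_two_of]

/-- **`[GL₂(𝔽₃) : SL₂(𝔽₃)] = 2`** (`#𝔽₃^× = 2`). [folklore] -/
theorem index_ker_det :
    (Matrix.GeneralLinearGroup.det : GL (Fin 2) (ZMod 3) →* (ZMod 3)ˣ).ker.index = 2 := by
  rw [Subgroup.index_ker, MonoidHom.range_eq_top.mpr det_surjective, Subgroup.card_top,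
    Nat.card_eq_fintype_card, ZMod.card_units_eq_totient]
  decide

/-- **`SL₂(𝔽₃)` is the unique subgroup of index `2` of `GL₂(𝔽₃)`.** [folklore] -/
theorem eq_ker_det_of_index_two (H : Subgroup (GL (Fin 2) (ZMod 3))) (hH : H.index = 2) :
    H = (Matrix.GeneralLinearGroup.det : GL (Fin 2) (ZMod 3) →* (ZMod 3)ˣ).ker := by
  set K := (Matrix.GeneralLinearGroup.det : GL (Fin 2) (ZMod 3) →* (ZMod 3)ˣ).ker with hK
  have hle : K ≤ H := ker_det_le_of_index_two H hH
  have hrel : K.relIndex H * H.index = K.index := Subgroup.relIndex_mul_index hle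
  rw [hH, index_ker_det] at hrel
  have h1 : K.relIndex H = 1 := by omega
  exact le_antisymm (Subgroup.relIndex_eq_one.mp h1) hle

/-- Two subgroups of index `2` of `GL₂(𝔽₃)` coincide. [folklore] -/
theorem index_two_unique (H₁ H₂ : Subgroup (GL (Fin 2) (ZMod 3))) (h₁ : H₁.index = 2)
    (h₂ : H₂.index = 2) : H₁ = H₂ := by
  rw [eq_ker_det_of_index_two H₁ h₁, eq_ker_det_of_index_two H₂ h₂]

/-- **`[GL₂(𝔽₃), GL₂(𝔽₃)] = SL₂(𝔽₃)`**: `⊆` because `det` has abelian target, `⊇` because every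
element of determinant `1` is a commutator. Hence `GL₂(𝔽₃)^{ab} ≅ 𝔽₃^× ≅ ℤ/2` via `det`.
[folklore] -/
theorem commutator_eq_ker_det :
    commutator (GL (Fin 2) (ZMod 3)) =
      (Matrix.GeneralLinearGroup.det : GL (Fin 2) (ZMod 3) →* (ZMod 3)ˣ).ker := by
  refine le_antisymm (Abelianization.commutator_subset_ker _) ?_
  intro g hg
  obtain ⟨a, b, rfl⟩ := exists_eq_commutatorElement g ((mem_ker_det_iff g).mp hg)
  rw [commutator_def]
  exact Subgroup.commutator_mem_commutator (Subgroup.mem_top a) (Subgroup.mem_top b)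

/-- The scalar `−1 ∈ GL₂(𝔽₃)`. [folklore] -/
noncomputable def negOne : GL (Fin 2) (ZMod 3) :=
  Matrix.GeneralLinearGroup.mkOfDetNeZero (-1) (by rw [Matrix.det_neg, Matrix.det_one]; decide)

/-- The underlying matrix of `negOne` is `−1`. [folklore] -/
@[simp] theorem val_negOne : ((negOne : GL (Fin 2) (ZMod 3)) : Matrix (Fin 2) (Fin 2) (ZMod 3)) = -1 :=
  rfl

/-- **`−1 ∈ [GL₂(𝔽₃), GL₂(𝔽₃)]`** (`det(−1) = 1`; explicitly `−1 = [i, j]` in `Q₈ ⊂ SL₂(𝔽₃)`).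
[folklore] -/
theorem negOne_mem_commutator : negOne ∈ commutator (GL (Fin 2) (ZMod 3)) := by
  rw [commutator_eq_ker_det, mem_ker_det_iff, val_negOne, Matrix.det_neg, Matrix.det_one]
  decide

/-! ### Transport to any group isomorphic to `GL₂(𝔽₃)` and to surjections onto it -/

section Transport

variable {A : Type*} [Group A] (e : A ≃* GL (Fin 2) (ZMod 3))

/-- In a group `A ≅ GL₂(𝔽₃)`, every index-`2` subgroup is the kernel of `det ∘ e`. [folklore] -/
theorem eq_ker_of_index_two_of_mulEquiv (H : Subgroup A) (hH : H.index = 2) :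
    H = ((Matrix.GeneralLinearGroup.det : GL (Fin 2) (ZMod 3) →* (ZMod 3)ˣ).comp
      e.toMonoidHom).ker := by
  have hmap : (H.map e.toMonoidHom).index = 2 := by
    rw [Subgroup.index_map_of_bijective (f := e.toMonoidHom) e.bijective, hH]
  have hker := eq_ker_det_of_index_two (H.map e.toMonoidHom) hmap
  rw [← MonoidHom.comap_ker, ← hker, Subgroup.comap_map_eq_self_of_injective e.injective]

include e in
/-- In a group `A ≅ GL₂(𝔽₃)` there is at most one subgroup of index `2`. [folklore] -/
theorem index_two_unique_of_mulEquiv (H₁ H₂ : Subgroup A) (h₁ : H₁.index = 2)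
    (h₂ : H₂.index = 2) : H₁ = H₂ := by
  rw [eq_ker_of_index_two_of_mulEquiv e H₁ h₁, eq_ker_of_index_two_of_mulEquiv e H₂ h₂]

variable {Γ : Type*} [Group Γ]

/-- **A surjection onto `GL₂(𝔽₃)` stays surjective on every index-`2` subgroup except the
determinant kernel.** For `ρ : Γ →* A` onto, `A ≅ GL₂(𝔽₃)` via `e`, and `Γ' ≤ Γ` of index `2`:
either `ρ(Γ') = A`, or `Γ' = ker(det ∘ e ∘ ρ)`. (Dictionary for X11b at `3`: `Γ = G_ℚ`, `Γ' = G_K`,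
`ρ = ρ̄_{E,3}`, `det ∘ ρ̄ = χ₃`, `ker χ₃ = G_{ℚ(√−3)}` — so `K ≠ ℚ(√−3)` forces `ρ̄(G_K) = Aut(E[3])`.)
[folklore] -/
theorem map_eq_top_or_eq_ker_of_index_two (ρ : Γ →* A) (hρ : Function.Surjective ρ)
    (Γ' : Subgroup Γ) (hΓ' : Γ'.index = 2) :
    Γ'.map ρ = ⊤ ∨
      Γ' = (((Matrix.GeneralLinearGroup.det : GL (Fin 2) (ZMod 3) →* (ZMod 3)ˣ).comp
        e.toMonoidHom).comp ρ).ker := by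
  have hdvd : (Γ'.map ρ).index ∣ 2 := hΓ' ▸ Subgroup.index_map_dvd Γ' hρ
  have h12 : (Γ'.map ρ).index = 1 ∨ (Γ'.map ρ).index = 2 := by
    have := Nat.le_of_dvd two_pos hdvd
    interval_cases h : (Γ'.map ρ).index
    · exact absurd hdvd (by decide)
    · exact Or.inl rfl
    · exact Or.inr rfl
  rcases h12 with h1 | h2
  · exact Or.inl (Subgroup.index_eq_one.mp h1)
  · right
    have hker := eq_ker_of_index_two_of_mulEquiv e (Γ'.map ρ) h2
    -- `Γ' ≤ ρ⁻¹(ker(det ∘ e))`, both of index 2 in `Γ`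
    set L := (((Matrix.GeneralLinearGroup.det : GL (Fin 2) (ZMod 3) →* (ZMod 3)ˣ).comp
        e.toMonoidHom).comp ρ).ker with hL
    have hle : Γ' ≤ L := by
      rw [hL, ← MonoidHom.comap_ker, ← hker]
      exact Subgroup.le_comap_map ρ Γ'
    have hLidx : L.index = 2 := by
      rw [hL, ← MonoidHom.comap_ker, Subgroup.index_comap_of_surjective _ hρ, ← hker, h2]
    have hrel : Γ'.relIndex L * L.index = Γ'.index := Subgroup.relIndex_mul_index hle
    rw [hΓ', hLidx] at hrel
    have h1 : Γ'.relIndex L = 1 := by omega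
    exact le_antisymm hle (Subgroup.relIndex_eq_one.mp h1)

/-- The same with the conclusion "the restriction of `ρ` to `Γ'` is onto `A`". [folklore] -/
theorem surjective_comp_subtype_or_eq_ker_of_index_two (ρ : Γ →* A) (hρ : Function.Surjective ρ)
    (Γ' : Subgroup Γ) (hΓ' : Γ'.index = 2) :
    Function.Surjective (ρ.comp Γ'.subtype) ∨
      Γ' = (((Matrix.GeneralLinearGroup.det : GL (Fin 2) (ZMod 3) →* (ZMod 3)ˣ).comp
        e.toMonoidHom).comp ρ).ker := by
  rcases map_eq_top_or_eq_ker_of_index_two e ρ hρ Γ' hΓ' with h | h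
  · left
    rw [← MonoidHom.range_eq_top, MonoidHom.range_comp, Subgroup.range_subtype, h]
  · exact Or.inr h

end Transport

end GL2F3

end Summit.BirchSwinnertonDyer.Rank1Residual.X11b.Three
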